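import Literature.AlgebraicTopology.CharacteristicClasses.TautologicalGysin
import Literature.AlgebraicTopology.CharacteristicClasses.ProjectiveHyperplaneCover
import HarnessLib

/-!
# `H*(U × ℙ(V))` is free over `H*(U)` on `1, x, …, xⁿ⁻¹` (Leray–Hirsch for trivial projective bundles)

D. Husemoller, *Fibre Bundles* (3rd ed. 1994), Ch. 17 §2 Thm. 2.3 (`H*(ℂPⁿ⁻¹)` is free on
`1, a, …, aⁿ⁻¹`) and Thm. 2.5 / Thm. 1.1 in the product case (`E = B × ℂPⁿ⁻¹`); A. Hatcher,
*Algebraic Topology* (2002), Thm. 3.16 (`H*(X × ℂPⁿ)`) and the cell structure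
`ℂPⁿ = ℂPⁿ⁻¹ ∪ e²ⁿ` (Ch. 0 p. 7). For a finite-dimensional complex normed space `V` of dimension
`n ≥ 1`, `x = e(γ¹(V)) ∈ H²(ℙ(V); R)` (`tautEuler`) and ANY space `U`:

* **`projectiveSpace_lerayHirsch`**: the Leray–Hirsch comparison map
  `(aⱼ)_{j<n} ↦ Σⱼ pr₁^* aⱼ ⌣ pr₂^* xʲ : Π_{j<n, 2j ≤ k} Hᵏ⁻²ʲ(U) → Hᵏ(U × ℙ(V))` is bijective for every
  `k` — the local input of Leray–Hirsch for projective bundles.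

Proof by induction on `n` along the hyperplane cover `ℙ(V) = U_ψ ∪ (ℙ(V) ∖ [u])`
(`ProjectiveHyperplaneCover`, `ProjectiveDeformation`: the chart `U_ψ` is contractible, the
complement of its centre retracts onto `ℙ(W)`, `W` a hyperplane, and the overlap is
`W ∖ 0 ≃ S²ⁿ⁻³`): restriction to `U × (ℙ(V) ∖ [u]) ≃ U × ℙ(W)` is the induction hypothesis on the
first `n - 1` classes (naturality of `x`, `TautologicalEulerClass.tautEuler_map`), hence surjective,
so the pair sequence splits; the kernel is, by excision and the cup-sphere structure of
`U × (W ∖ 0)` (`PuncturedCupSphere`), the set of `pr₂^* g_Y ⌣ pr₁^* c` for the suspended class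
`g_Y ∈ H²ⁿ⁻²(ℙ(V))` (`CupSphereLadder.suspCls`), bijectively in `c`; finally `xⁿ⁻¹ = unit • g_Y` by
the Gysin surjectivity `⌣x : H²ⁿ⁻⁴ ↠ H²ⁿ⁻²` (`TautologicalGysin`) and the freeness in degree
`2n - 4` (induction). Everything is proved; no named facts.

## References

* D. Husemoller, *Fibre Bundles*, GTM 20, Springer 1994, Ch. 17 §1 Thm. 1.1, §2 Thm. 2.3, Thm. 2.5. [HusemollerFibreBundles1994]
* A. Hatcher, *Algebraic Topology*, CUP 2002, Ch. 0 p. 7, §3.2 Thm. 3.16, Thm. 3.19. [HatcherAT2002]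
-/

noncomputable section

open CategoryTheory Function Set Bundle Module Literature.AlgebraicTopology.SingularHomology
  Literature.AlgebraicTopology.SingularHomology.LerayHirsch
open scoped LinearAlgebra.Projectivization

namespace Literature.AlgebraicTopology.CharacteristicClasses

/-! ### Cup powers, degree casts, the classes `pr₂^* xʲ` -/

section Prelim

variable (R : Type) [CommRing R]

/-- Cup powers `xʲ ∈ H²ʲ(X; R)` of a degree-`2` class. [cite: HatcherAT2002, §3.2 p. 212] -/
def cupPow {X : Type} [TopologicalSpace X] (x : singularCohomology R R X 2) : (j : ℕ) → singularCohomology R R X (2 * j)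
  | 0 => singularCohomology.one R X
  | j + 1 => cupProduct (show 2 * j + 2 = 2 * (j + 1) by omega) (cupPow x j) x

/-- `x⁰ = 1`. [folklore] -/
theorem cupPow_zero {X : Type} [TopologicalSpace X] (x : singularCohomology R R X 2) : cupPow R x 0 = singularCohomology.one R X := rfl

/-- `xʲ⁺¹ = xʲ ⌣ x`. [folklore] -/
theorem cupPow_succ {X : Type} [TopologicalSpace X] (x : singularCohomology R R X 2) (j : ℕ) :
    cupPow R x (j + 1) = cupProduct (show 2 * j + 2 = 2 * (j + 1) by omega) (cupPow R x j) x := rfl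

/-- `f^*(xʲ) = (f^*x)ʲ`. [cite: HatcherAT2002, Prop. 3.10] -/
theorem map_cupPow {X Y : Type} [TopologicalSpace X] [TopologicalSpace Y] (f : C(X, Y)) (x : singularCohomology R R Y 2) :
    ∀ j : ℕ, singularCohomology.map R R f (2 * j) (cupPow R x j) = cupPow R (singularCohomology.map R R f 2 x) j
  | 0 => singularCohomology.map_one f
  | j + 1 => by rw [cupPow_succ, cupPow_succ, cupProduct_map, map_cupPow f x j]

/-- `r • xʲ ⌣ x = r • xʲ⁺¹`-type bookkeeping: `(r • y) ⌣ x = r • (y ⌣ x)`. [folklore] -/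
theorem smul_cupProduct {X : Type} [TopologicalSpace X] {p q n : ℕ} (h : p + q = n) (r : R)
    (y : singularCohomology R R X p) (x : singularCohomology R R X q) : cupProduct h (r • y) x = r • cupProduct h y x := by
  rw [LinearMap.map_smul, LinearMap.smul_apply]

/-- **Degree casts** `Hᵃ ≅ Hᵇ` along `a = b` (to bridge the subtraction-form degrees of the
Leray–Hirsch sources and the addition-form degrees of the two-piece machinery). [folklore] -/
def degCast {X : Type} [TopologicalSpace X] {a b : ℕ} (e : a = b) : singularCohomology R R X a ≃ₗ[R] singularCohomology R R X b := by
  subst e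
  exact LinearEquiv.refl R _

/-- `degCast rfl = 𝟙`. [folklore] -/
@[simp]
theorem degCast_rfl {X : Type} [TopologicalSpace X] {a : ℕ} (y : singularCohomology R R X a) : degCast R (rfl : a = a) y = y := rfl

/-- `degCast e.symm ∘ degCast e = 𝟙`. [folklore] -/
@[simp]
theorem degCast_symm_apply_degCast {X : Type} [TopologicalSpace X] {a b : ℕ} (e : a = b) (y : singularCohomology R R X a) :
    degCast R e.symm (degCast R e y) = y := by
  subst e; rfl

/-- Casts commute with induced maps. [folklore] -/
theorem map_degCast {X Y : Type} [TopologicalSpace X] [TopologicalSpace Y] (f : C(X, Y)) {a b : ℕ} (e : a = b)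
    (y : singularCohomology R R Y a) :
    singularCohomology.map R R f b (degCast R e y) = degCast R e (singularCohomology.map R R f a y) := by
  subst e; rfl

/-- Casts are absorbed by the cup product (left factor). [folklore] -/
theorem cupProduct_degCast_left {X : Type} [TopologicalSpace X] {a b q n : ℕ} (e : a = b) (h : b + q = n) (h' : a + q = n)
    (y : singularCohomology R R X a) (z : singularCohomology R R X q) :
    cupProduct h (degCast R e y) z = cupProduct h' y z := by
  subst e; rfl

/-- Casts are absorbed by the cup product (right factor). [folklore] -/
theorem cupProduct_degCast_right {X : Type} [TopologicalSpace X] {a b p n : ℕ} (e : a = b) (h : p + b = n) (h' : p + a = n)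
    (y : singularCohomology R R X p) (z : singularCohomology R R X a) :
    cupProduct h y (degCast R e z) = cupProduct h' y z := by
  subst e; rfl

variable (V : Type) [NormedAddCommGroup V] [NormedSpace ℂ V] [FiniteDimensional ℂ V]

/-- `xʲ ∈ H²ʲ(ℙ(V); R)`, the powers of `x = e(γ¹(V))`. [cite: HusemollerFibreBundles1994, Ch. 17 §2 Thm. 2.3] -/
def xpow (j : ℕ) : singularCohomology R R (ℙ ℂ V) (2 * j) := cupPow R (tautEuler V R 1) j

/-- **The Leray–Hirsch classes `pr₂^* xʲ ∈ H²ʲ(U × ℙ(V))`, `j < N`.** [cite: HusemollerFibreBundles1994, Ch. 17 §2 Thm. 2.5] -/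
def projCls (U : Type) [TopologicalSpace U] (N : ℕ) (j : Fin N) : singularCohomology R R (U × ℙ ℂ V) (evenDeg N j) :=
  singularCohomology.map R R (ContinuousMap.snd : C(U × ℙ ℂ V, ℙ ℂ V)) (2 * (j : ℕ)) (xpow R V j)

/-- **The statement `LH(V, N)`**: for every space `U` the comparison map with the classes
`pr₂^* xʲ` (`j < N`) is bijective in every degree. [cite: HusemollerFibreBundles1994, Ch. 17 §2 Thm. 2.5] -/
def IsProjLH (N : ℕ) : Prop :=
  ∀ (U : Type) [TopologicalSpace U] (k : ℕ),
    Bijective (lhMap R (evenDeg N) (ContinuousMap.fst : C(U × ℙ ℂ V, U)) (projCls R V U N) k)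

variable {V R} in
/-- `xʲ` is natural under linear injections (`ℙ(i)^* x_V = x_W`). [cite: HusemollerFibreBundles1994, Ch. 17 Prop. 3.3] -/
theorem map_projMapC_xpow {W : Type} [NormedAddCommGroup W] [NormedSpace ℂ W] [FiniteDimensional ℂ W]
    (i : W →ₗ[ℂ] V) (hi : Injective i) (j : ℕ) :
    singularCohomology.map R R (projMapC i hi) (2 * j) (xpow R V j) = xpow R W j := by
  rw [xpow, map_cupPow, ← tautEuler_map]
  rfl

end Prelim

/-! ### Vanishing bookkeeping at a point -/

section Point

variable (R : Type) [CommRing R]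

/-- `Hᵈ(pt; R) = 0` for `d ≠ 0`. [cite: HatcherAT2002, §3.1 p. 199] -/
theorem punit_eq_zero {d : ℕ} (hd : d ≠ 0) (y : singularCohomology R R PUnit.{1} d) : y = 0 :=
  ModuleCat.eq_zero_of_isZero_obj (singularCochainComplex.isZero_singularCohomology_of_subsingleton' (R := R) (M := R) hd) y

/-- Every class of `H⁰(pt; R)` is `r • 1`. [cite: HatcherAT2002, §3.1 p. 199] -/
theorem punit_zero_eq_smul_one (c : singularCohomology R R PUnit.{1} 0) : ∃ r : R, c = r • singularCohomology.one R PUnit.{1} := by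
  obtain ⟨r, rfl⟩ := exists_eq_constClass_punit R R c
  exact ⟨r, constClass_eq_smul_one R PUnit.{1} r⟩

/-- `r • 1 = 0` in `H⁰(pt; R)` forces `r = 0`. [cite: HatcherAT2002, §3.1 p. 199] -/
theorem eq_zero_of_smul_one_punit {r : R} (h : r • singularCohomology.one R PUnit.{1} = 0) : r = 0 := by
  rw [← constClass_eq_smul_one] at h
  exact (constClass_eq_zero_iff (R := R) (M := R) PUnit.{1} r).1 h

/-- **A source whose components all have positive degree vanishes at a point**: for classes
indexed by `Fin N` in even degrees and `k` with `2j ≠ k` for all `j < N`, every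
`a ∈ Π_{2j ≤ k} Hᵏ⁻²ʲ(pt)` is `0`. [folklore] -/
theorem src_punit_eq_zero {N k : ℕ} (hk : ∀ j : ℕ, j < N → 2 * j ≠ k) (a : Src R (evenDeg N) PUnit.{1} k) : a = 0 :=
  funext fun j ↦ punit_eq_zero R (by
    obtain ⟨⟨j, hjN⟩, hj⟩ := j
    change 2 * j ≤ k at hj
    change k - 2 * j ≠ 0
    have := hk j hjN
    omega) (a j)

end Point

/-! ### The base case: `dim V = 1`, `ℙ(V)` a point -/

section Base

variable (R : Type) [CommRing R] (V : Type) [NormedAddCommGroup V] [NormedSpace ℂ V] [FiniteDimensional ℂ V]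

/-- For `dim V = 1`, `ℙ(V)` has exactly one point. [folklore] -/
abbrev uniqueProjectivization (hV : finrank ℂ V = 1) : Unique (ℙ ℂ V) := by
  have hne : ∃ v : V, v ≠ 0 := by
    by_contra h
    simp only [not_exists, not_not] at h
    haveI : Subsingleton V := ⟨fun a b ↦ by rw [h a, h b]⟩
    have : finrank ℂ V = 0 := Module.finrank_zero_of_subsingleton
    omega
  refine ⟨⟨Projectivization.mk ℂ hne.choose hne.choose_spec⟩, fun p ↦ ?_⟩
  induction p using Projectivization.ind with
  | h w hw =>
    obtain ⟨c, hc⟩ := (finrank_eq_one_iff_of_nonzero' hne.choose hne.choose_spec).1 hV w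
    have hc0 : c ≠ 0 := fun h ↦ hw (by rw [← hc, h, zero_smul])
    exact (Projectivization.mk_eq_mk_iff ℂ _ _ hw hne.choose_spec).2 ⟨Units.mk0 c hc0, by rw [← hc]; rfl⟩

/-- **`LH(V, 1)` for `dim V = 1`**: `U × ℙ(V) ≅ U` and the comparison map is `pr₁^*`. [folklore] -/
theorem isProjLH_one (hV : finrank ℂ V = 1) : IsProjLH R V 1 := by
  intro U _ k
  letI := uniqueProjectivization V hV
  rw [bijective_lhMap_one_iff]
  have hcls : projCls R V U 1 0 = singularCohomology.one R (U × ℙ ℂ V) := by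
    change singularCohomology.map R R ContinuousMap.snd (2 * 0) (cupPow R (tautEuler V R 1) 0) = _
    rw [cupPow_zero, singularCohomology.map_one]
  have hcomp : (fun x : singularCohomology R R U k ↦ cupProduct (show k + 0 = k from rfl)
      (singularCohomology.map R R (ContinuousMap.fst : C(U × ℙ ℂ V, U)) k x) (projCls R V U 1 0)) =
      singularCohomology.map R R (ContinuousMap.fst : C(U × ℙ ℂ V, U)) k := by
    funext x
    rw [hcls, cupProduct_one]
  rw [hcomp]
  exact (singularCohomology.mapIso R R (Homeomorph.prodUnique U (ℙ ℂ V)) k).toLinearEquiv.bijective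

end Base

/-! ### The inductive step: from a hyperplane `W` to `V` -/

/-- **The data of the inductive step**: a functional `ψ` and a vector `u` with `ψ u = 1` on a space
of dimension `n + 2` (so `V = W ⊕ ℂu`, `W = ker ψ ≅ range(1 - u ⊗ ψ)` of dimension `n + 1`).
[cite: HatcherAT2002, Ch. 0 p. 7] -/
structure CellData (V : Type) [NormedAddCommGroup V] [NormedSpace ℂ V] [FiniteDimensional ℂ V] (n : ℕ) where
  /-- the functional -/
  ψ : V →L[ℂ] ℂ
  /-- the centre of the cell -/
  u : V
  /-- normalisation -/
  hu : ψ u = 1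
  /-- the dimension -/
  hV : finrank ℂ V = n + 2

section Step

variable (R : Type) [CommRing R] {V : Type} [NormedAddCommGroup V] [NormedSpace ℂ V] [FiniteDimensional ℂ V] {n : ℕ}
  (D : CellData V n)

namespace CellData

/-- The projection `1 - u ⊗ ψ` onto the hyperplane. [cite: HatcherAT2002, Ch. 0 p. 7] -/
abbrev P : V →L[ℂ] V := hyperplaneProj D.ψ D.u

/-- The hyperplane `W = range(1 - u ⊗ ψ)` as a normed space. [cite: HatcherAT2002, Ch. 0 p. 7] -/
abbrev Hyp : Type := ↥(LinearMap.range ((D.P : V →L[ℂ] V) : V →ₗ[ℂ] V))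

/-- The affine chart `U_ψ` (the open top cell). [cite: HatcherAT2002, Ch. 0 p. 7] -/
abbrev A : Set (ℙ ℂ V) := chartDomain ((D.ψ : V →L[ℂ] ℂ) : Module.Dual ℂ V)

/-- The complement `ℙ(V) ∖ [u]` of the centre of the cell. [cite: HatcherAT2002, Ch. 0 p. 7] -/
abbrev C : Set (ℙ ℂ V) := projChart D.P

/-- `P² = P`. [folklore] -/
theorem hP : ∀ v, D.P (D.P v) = D.P v := hyperplaneProj_idem D.hu

/-- `dim W = n + 1`. [folklore] -/
theorem finrank_hyp : finrank ℂ D.Hyp = n + 1 :=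
  Nat.succ.inj ((finrank_range_hyperplaneProj D.hu).trans D.hV)

/-- `A` is open. [folklore] -/
theorem isOpen_A : IsOpen D.A := isOpen_chartDomain _ D.ψ.continuous

/-- `C` is open. [folklore] -/
theorem isOpen_C : IsOpen D.C := isOpen_projChart _

/-- `C ∪ A = ℙ(V)`. [cite: HatcherAT2002, Ch. 0 p. 7] -/
theorem C_union_A : D.C ∪ D.A = univ := by
  rw [union_comm]; exact chartDomain_union_projChart D.hu

/-- `A` is contractible. [cite: HatcherAT2002, Ch. 0 p. 7] -/
instance contractibleSpace_A : ContractibleSpace ↥D.A := contractibleSpace_chartDomain D.hu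

/-- A point of the overlap `C ∩ A`: `[w₀ + u]` for a non-zero `w₀ ∈ ker ψ` (exists as `dim V ≥ 2`). [folklore] -/
theorem exists_mem_C_inter_A : ∃ p : ℙ ℂ V, p ∈ D.C ∩ D.A := by
  have hk : 0 < finrank ℝ ↥(LinearMap.ker (D.ψ : V →ₗ[ℂ] ℂ)) := by rw [finrank_real_ker D.hu, D.hV]; omega
  obtain ⟨w, hw⟩ := (finrank_pos_iff_exists_ne_zero (R := ℝ)).1 hk
  exact ⟨_, mk_add_mem_projChart D.hu ⟨w, hw⟩, mk_add_mem_chartDomain D.hu w⟩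

/-- The chosen point of the overlap. [folklore] -/
def z₀ : ℙ ℂ V := D.exists_mem_C_inter_A.choose

/-- It lies in the overlap. [folklore] -/
theorem z₀_mem : D.z₀ ∈ D.C ∩ D.A := D.exists_mem_C_inter_A.choose_spec

/-- **The overlap `C ∩ A ≅ W ∖ 0` is a cup-sphere of level `2n + 1`** (`PuncturedCupSphere`).
[cite: HatcherAT2002, Ch. 0 p. 7, §3.2 Example 3.11] -/
theorem exists_isCupSphere_overlap : ∃ g : singularCohomology R R ↥(D.C ∩ D.A) (2 * n + 1),
    IsCupSphere R ↥(D.C ∩ D.A) (2 * n + 1) g := by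
  obtain ⟨g₀, hg₀⟩ := exists_isCupSphere_ne_zero R ↥(LinearMap.ker (D.ψ : V →ₗ[ℂ] ℂ)) (N := 2 * n + 1)
    (by rw [finrank_real_ker D.hu, D.hV]; omega)
  let e : ↥(D.C ∩ D.A) ≃ₜ {w : ↥(LinearMap.ker (D.ψ : V →ₗ[ℂ] ℂ)) // w ≠ 0} :=
    (Homeomorph.setCongr (inter_comm _ _)).trans (puncturedChartHomeomorph D.hu)
  exact ⟨_, hg₀.of_homeomorph e⟩

/-- The sphere class `g ∈ H²ⁿ⁺¹(C ∩ A)` of the overlap. [folklore] -/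
def gZ : singularCohomology R R ↥(D.C ∩ D.A) (2 * n + 1) := (D.exists_isCupSphere_overlap R).choose

/-- It makes the overlap a cup-sphere of level `2n + 1`. [folklore] -/
theorem isCupSphere_gZ : IsCupSphere R ↥(D.C ∩ D.A) (2 * n + 1) (D.gZ R) := (D.exists_isCupSphere_overlap R).choose_spec

/-- **The suspended class `g_Y ∈ H²ⁿ⁺²(ℙ(V))`** (`CupSphereLadder.suspCls` for the cover `C ∪ A`).
[cite: HatcherAT2002, §3.2 Thm. 3.16 (proof)] -/
def gY : singularCohomology R R (ℙ ℂ V) (2 * n + 1 + 1) := suspCls R D.isOpen_C D.isOpen_A D.C_union_A (D.gZ R)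

/-! #### The comparison with `U × ℙ(W)` over the piece `U × C` -/

variable (U : Type) [TopologicalSpace U]

/-- `G : U × ℙ(W) → ↥(U × C)`, `(u', m) ↦ (u', ℙ(ι) m)` (`ι : W ↪ V`). [cite: HatcherAT2002, Ch. 0 Example 0.6] -/
def compG : C(U × ℙ ℂ D.Hyp, ↥(vert U D.C)) where
  toFun p := ⟨(p.1, rangeProjectivizationMap D.P p.2),
    show rangeProjectivizationMap D.P p.2 ∈ projChart D.P from
      rangeLocus_subset_projChart _ (by rw [← range_rangeProjectivizationMap D.P D.hP]; exact mem_range_self _)⟩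
  continuous_toFun := (continuous_fst.prodMk ((continuous_rangeProjectivizationMap _).comp continuous_snd)).subtype_mk _

/-- `G = (vertHomeomorph)⁻¹ ∘ (𝟙 × incl) ∘ (𝟙 × rangeLocusHomeomorph)`. [folklore] -/
theorem compG_eq :
    D.compG U = ((vertHomeomorph U D.C).symm : C(U × ↥D.C, ↥(vert U D.C))).comp
      (((ContinuousMap.id U).prodMap (rangeLocusInclusion D.P)).comp
        ((ContinuousMap.id U).prodMap (rangeLocusHomeomorph D.P D.hP : C(ℙ ℂ D.Hyp, ↥(rangeLocus D.P))))) := by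
  ext ⟨u', m⟩ <;> rfl

/-- **`G^*` is bijective** (a homeomorphism, a homotopy equivalence, a homeomorphism). [cite: HatcherAT2002, Ch. 0 Example 0.6, Cor. 2.11] -/
theorem map_compG_bijective (i : ℕ) : Bijective (singularCohomology.map R R (D.compG U) i) := by
  rw [compG_eq, singularCohomology.map_comp, singularCohomology.map_comp]
  refine (Bijective.comp ?_ ?_).comp ?_
  · exact (singularCohomology.mapIso R R ((Homeomorph.refl U).prodCongr (rangeLocusHomeomorph D.P D.hP)) i).toLinearEquiv.bijective
  · exact (singularCohomology.isoOfHomotopyEquiv' R R ((ContinuousMap.HomotopyEquiv.refl U).prodCongr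
      (rangeLocusHomotopyEquiv D.P D.hP)) i).toLinearEquiv.bijective
  · exact (singularCohomology.mapIso R R (vertHomeomorph U D.C).symm i).toLinearEquiv.bijective

/-- The first `n + 1` classes restricted to the piece `U × C`. [folklore] -/
def clsC (j : Fin (n + 1)) : singularCohomology R R ↥(vert U D.C) (evenDeg (n + 1) j) :=
  singularCohomology.map R R (subsetIncl (vert U D.C)) (2 * (j : ℕ))
    (singularCohomology.map R R (ContinuousMap.snd : C(U × ℙ ℂ V, ℙ ℂ V)) (2 * (j : ℕ)) (xpow R V j))

/-- `clsC j` is the restriction of the `j`-th of the `n + 2` classes of `U × ℙ(V)`. [folklore] -/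
theorem clsC_eq (j : Fin (n + 1)) :
    D.clsC R U j = singularCohomology.map R R (subsetIncl (vert U D.C)) (evenDeg (n + 2) (Fin.castSucc j))
      (projCls R V U (n + 2) (Fin.castSucc j)) := rfl

/-- `pr₂ ∘ incl ∘ G = ℙ(ι) ∘ pr₂`. [folklore] -/
theorem snd_comp_compG :
    (ContinuousMap.snd : C(U × ℙ ℂ V, ℙ ℂ V)).comp ((subsetIncl (vert U D.C)).comp (D.compG U)) =
      (projMapC ((LinearMap.range ((D.P : V →L[ℂ] V) : V →ₗ[ℂ] V)).subtype) (Submodule.injective_subtype _)).comp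
        (ContinuousMap.snd : C(U × ℙ ℂ D.Hyp, ℙ ℂ D.Hyp)) := by
  ext ⟨u', m⟩; rfl

/-- **`G^*` matches the classes**: `G^*(pr₂^* x_Vʲ|) = pr₂^* x_Wʲ` (naturality of `x`). [cite: HusemollerFibreBundles1994, Ch. 17 Prop. 3.3] -/
theorem map_compG_clsC (j : Fin (n + 1)) :
    singularCohomology.map R R (D.compG U) (evenDeg (n + 1) j) (D.clsC R U j) = projCls R D.Hyp U (n + 1) j := by
  rw [clsC, projCls, ← ModuleCat.comp_apply, ← singularCohomology.map_comp, ← ModuleCat.comp_apply,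
    ← singularCohomology.map_comp, snd_comp_compG, singularCohomology.map_comp,
    ModuleCat.comp_apply, map_projMapC_xpow]

/-- `pr₁| ∘ G = pr₁`. [folklore] -/
theorem fstVert_comp_compG : (fstVert U D.C).comp (D.compG U) = (ContinuousMap.id U).comp ContinuousMap.fst := rfl

/-- **Restriction to the piece is the induction hypothesis**: if `LH(W, n+1)` holds then the
comparison map of `U × C → U` with the first `n + 1` restricted classes is bijective.
[cite: HusemollerFibreBundles1994, Ch. 17 §1 Thm. 1.1 (proof)] -/
theorem bijective_lhMap_piece (hW : IsProjLH R D.Hyp (n + 1)) (k : ℕ) :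
    Bijective (lhMap R (evenDeg (n + 1)) (fstVert U D.C) (D.clsC R U) k) :=
  (bijective_iff_of_square R (evenDeg (n + 1)) (fstVert U D.C) (ContinuousMap.fst : C(U × ℙ ℂ D.Hyp, U))
    (D.compG U) (ContinuousMap.id U) (D.fstVert_comp_compG U) (D.clsC R U) (projCls R D.Hyp U (n + 1)) (D.map_compG_clsC R U)
    (D.map_compG_bijective R U) (fun i ↦ by rw [singularCohomology.map_id]; exact bijective_id)).2 (hW U) k

/-! #### The restriction to the piece: `r ∘ Φ = Φ_low ∘ restrict`, `r` surjective, `toAbsolute` injective -/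

/-- `G^*` of restricted powers. [folklore] -/
theorem map_compG_res_xpow (j : ℕ) :
    singularCohomology.map R R (D.compG U) (2 * j) (singularCohomology.map R R (subsetIncl (vert U D.C)) (2 * j)
      (singularCohomology.map R R (ContinuousMap.snd : C(U × ℙ ℂ V, ℙ ℂ V)) (2 * j) (xpow R V j))) =
      singularCohomology.map R R (ContinuousMap.snd : C(U × ℙ ℂ D.Hyp, ℙ ℂ D.Hyp)) (2 * j) (xpow R D.Hyp j) := by
  rw [← ModuleCat.comp_apply, ← singularCohomology.map_comp, ← ModuleCat.comp_apply, ← singularCohomology.map_comp,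
    snd_comp_compG, singularCohomology.map_comp, ModuleCat.comp_apply, map_projMapC_xpow]

/-- **Top vanishing for the hyperplane**: `x_Wⁿ⁺¹ = 0` (`H²ⁿ⁺²(pt × ℙ(W))` has a vanishing source). [cite: HusemollerFibreBundles1994, Ch. 17 §2 Thm. 2.3] -/
theorem xpow_hyp_eq_zero (hW : IsProjLH R D.Hyp (n + 1)) : xpow R D.Hyp (n + 1) = 0 := by
  have hinj : Injective (singularCohomology.map R R (ContinuousMap.snd : C(PUnit.{1} × ℙ ℂ D.Hyp, ℙ ℂ D.Hyp)) (2 * (n + 1))) :=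
    (singularCohomology.mapIso R R (Homeomorph.punitProd (ℙ ℂ D.Hyp)) (2 * (n + 1))).toLinearEquiv.injective
  apply hinj
  rw [map_zero]
  obtain ⟨a, ha⟩ := (hW PUnit.{1} (2 * (n + 1))).2
    (singularCohomology.map R R (ContinuousMap.snd : C(PUnit.{1} × ℙ ℂ D.Hyp, ℙ ℂ D.Hyp)) (2 * (n + 1)) (xpow R D.Hyp (n + 1)))
  rw [← ha, src_punit_eq_zero R (N := n + 1) (k := 2 * (n + 1)) (fun j hj ↦ by omega) a, LinearMap.map_zero]

/-- The top class restricts to `0` on the piece `U × C`. [folklore] -/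
theorem res_projCls_last (hW : IsProjLH R D.Hyp (n + 1)) :
    singularCohomology.map R R (subsetIncl (vert U D.C)) (2 * (n + 1))
      (projCls R V U (n + 2) (Fin.last (n + 1))) = 0 := by
  change singularCohomology.map R R (subsetIncl (vert U D.C)) (2 * (n + 1))
    (singularCohomology.map R R (ContinuousMap.snd : C(U × ℙ ℂ V, ℙ ℂ V)) (2 * (n + 1)) (xpow R V (n + 1))) = 0
  apply (D.map_compG_bijective R U (2 * (n + 1))).1
  rw [map_compG_res_xpow, xpow_hyp_eq_zero R D hW, map_zero, map_zero]

/-- **`r ∘ Φ = Φ_low ∘ restrict`**: restricting the comparison map with `n + 2` classes to the piece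
gives the comparison map of the piece with the first `n + 1` classes (the top class dies there).
[cite: HusemollerFibreBundles1994, Ch. 17 §1 Thm. 1.1 (proof)] -/
theorem res_lhMap (hW : IsProjLH R D.Hyp (n + 1)) (k : ℕ) (a : Src R (evenDeg (n + 2)) U k) :
    singularCohomology.map R R (subsetIncl (vert U D.C)) k
      (lhMap R (evenDeg (n + 2)) (ContinuousMap.fst : C(U × ℙ ℂ V, U)) (projCls R V U (n + 2)) k a) =
      lhMap R (evenDeg (n + 1)) (fstVert U D.C) (D.clsC R U) k (restrictSrc R (n + 1) k a) := by
  rw [lhMap_succ, map_add, map_lhMap R (evenDeg (n + 1)) ContinuousMap.fst (fstVert U D.C) (subsetIncl (vert U D.C))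
    (ContinuousMap.id U) rfl]
  have hs : (fun j : Idx (evenDeg (n + 1)) k ↦ singularCohomology.map R R (ContinuousMap.id U) (k - evenDeg (n + 1) j.1)
      (restrictSrc R (n + 1) k a j)) = restrictSrc R (n + 1) k a := funext fun j ↦ by
    rw [singularCohomology.map_id]; rfl
  have h0 : singularCohomology.map R R (subsetIncl (vert U D.C)) k
      (if h : 2 * (n + 1) ≤ k then cupProduct (Nat.sub_add_cancel h)
        (singularCohomology.map R R ContinuousMap.fst (k - 2 * (n + 1)) (a ⟨Fin.last (n + 1), h⟩))
        (projCls R V U (n + 2) (Fin.last (n + 1))) else 0) = 0 := by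
    split_ifs with h
    · rw [cupProduct_map, res_projCls_last R D U hW, LinearMap.map_zero]
    · rw [map_zero]
  rw [h0, add_zero]
  exact congrArg₂ (fun c s ↦ lhMap R (evenDeg (n + 1)) (fstVert U D.C) c k s) (funext fun j ↦ rfl) hs

/-- **The restriction `Hᵏ(U × ℙ(V)) → Hᵏ(U × C)` is surjective.** [cite: HusemollerFibreBundles1994, Ch. 17 §1 Thm. 1.1 (proof)] -/
theorem res_surjective (hW : IsProjLH R D.Hyp (n + 1)) (k : ℕ) :
    Surjective (singularCohomology.map R R (subsetIncl (vert U D.C)) k) := fun y ↦ by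
  obtain ⟨w, hw⟩ := (D.bijective_lhMap_piece R U hW k).2 y
  exact ⟨lhMap R (evenDeg (n + 2)) ContinuousMap.fst (projCls R V U (n + 2)) k (extendSrc R (n + 1) k w),
    by rw [res_lhMap R D U hW, restrictSrc_extendSrc, hw]⟩

/-- Hence **`Hᵏ(U × ℙ(V), U × C) → Hᵏ(U × ℙ(V))` is injective** (the pair sequence splits). [cite: HatcherAT2002, §3.1 p. 200] -/
theorem toAbsolute_eq_zero (hW : IsProjLH R D.Hyp (n + 1)) (k : ℕ) (ρ : relSingularCohomology R R (U × ℙ ℂ V) (vert U D.C) k)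
    (hρ : relSingularCohomology.toAbsolute R R (U × ℙ ℂ V) (vert U D.C) k ρ = 0) : ρ = 0 := by
  cases k with
  | zero => exact toAbsolute_zero_injective R R (vert U D.C) (hρ.trans (map_zero _).symm)
  | succ i =>
    obtain ⟨y, rfl⟩ := exists_of_moduleCat_exact
      (relSingularCohomology.exact_δ_toAbsolute (R := R) (M := R) (X := U × ℙ ℂ V) (vert U D.C) i (i + 1) rfl) ρ hρ
    obtain ⟨z, rfl⟩ := D.res_surjective R U hW i y
    change (singularCohomology.map R R (subsetIncl (vert U D.C)) i ≫
      relSingularCohomology.δ R R (U × ℙ ℂ V) (vert U D.C) i (i + 1) rfl) z = 0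
    rw [map_subsetIncl_comp_δ]
    rfl

/-! #### The kernel of the restriction: the classes `θ(c) = pr₂^* g_Y ⌣ pr₁^* c` -/

/-- **`θ(c) = κ(pr₂^* g ⌣ pr₁^* c) ∈ Hᵈ(U × ℙ(V))`**, `d = k' + 2n + 2` (degree bookkeeping through `e`). [cite: HatcherAT2002, §3.2 Thm. 3.16 (proof)] -/
def θ (k' d : ℕ) (e : k' + (2 * n + 1) + 1 = d) (c : singularCohomology R R U k') : singularCohomology R R (U × ℙ ℂ V) d :=
  degCast R e (twoPieceKappa R R (U := U) D.isOpen_C D.isOpen_A D.C_union_A (k' + (2 * n + 1))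
    (cupProduct (Nat.add_comm (2 * n + 1) k') (singularCohomology.map R R (sndZ U D.C D.A) (2 * n + 1) (D.gZ R))
      (singularCohomology.map R R (fstInter U D.C D.A) k' c)))

/-- **`θ(c) = pr₂^* g_Y ⌣ pr₁^* c`.** [cite: HatcherAT2002, §3.2 Thm. 3.16 (proof)] -/
theorem θ_eq (k' d : ℕ) (e : k' + (2 * n + 1) + 1 = d) (c : singularCohomology R R U k') :
    D.θ R U k' d e c = cupProduct (show (2 * n + 1 + 1) + k' = d by omega)
      (singularCohomology.map R R (ContinuousMap.snd : C(U × ℙ ℂ V, ℙ ℂ V)) (2 * n + 1 + 1) (D.gY R))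
      (singularCohomology.map R R (ContinuousMap.fst : C(U × ℙ ℂ V, U)) k' c) := by
  subst e
  rw [θ, degCast_rfl, gY]
  exact twoPieceKappa_sndZ_cup R D.isOpen_C D.isOpen_A D.C_union_A (D.gZ R) U c

/-- `θ` is linear: scalars. [folklore] -/
theorem θ_smul (k' d : ℕ) (e : k' + (2 * n + 1) + 1 = d) (r : R) (c : singularCohomology R R U k') :
    D.θ R U k' d e (r • c) = r • D.θ R U k' d e c := by
  rw [θ_eq, θ_eq, map_smul, LinearMap.map_smul]

/-- `θ` is linear: sums. [folklore] -/
theorem θ_add (k' d : ℕ) (e : k' + (2 * n + 1) + 1 = d) (c c' : singularCohomology R R U k') :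
    D.θ R U k' d e (c + c') = D.θ R U k' d e c + D.θ R U k' d e c' := by
  rw [θ_eq, θ_eq, θ_eq, map_add, LinearMap.map_add]

/-- `κ` kills the classes pulled back from `U`. [cite: HatcherAT2002, §3.1 p. 201] -/
theorem kappa_fstInter (i : ℕ) (a₁ : singularCohomology R R U i) :
    twoPieceKappa R R (U := U) D.isOpen_C D.isOpen_A D.C_union_A i (singularCohomology.map R R (fstInter U D.C D.A) i a₁) = 0 := by
  haveI := isIso_excMap R R (U := U) D.isOpen_C D.isOpen_A D.C_union_A (i + 1)
  rw [twoPieceKappa_apply, (δ_inter_eq_zero_iff_mem_range R R i (i + 1) rfl _).2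
    ⟨singularCohomology.map R R (fstVert U D.A) i a₁, by rw [← ModuleCat.comp_apply, ← singularCohomology.map_comp]; rfl⟩,
    map_zero, map_zero]

/-- A class vanishing on `U × C` is `κ(b)` for some `b ∈ Hⁱ(U × (C ∩ A))` (pair sequence, excision,
surjectivity of `δ` in the small pair). [cite: HatcherAT2002, §3.1 pp. 200–201] -/
theorem exists_kappa_eq {i : ℕ} (z : singularCohomology R R (U × ℙ ℂ V) (i + 1))
    (hz : singularCohomology.map R R (subsetIncl (vert U D.C)) (i + 1) z = 0) :
    ∃ b : singularCohomology R R ↥(inter U D.C D.A) i, twoPieceKappa R R (U := U) D.isOpen_C D.isOpen_A D.C_union_A i b = z := by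
  haveI := isIso_excMap R R (U := U) D.isOpen_C D.isOpen_A D.C_union_A (i + 1)
  obtain ⟨ρ, rfl⟩ := exists_of_moduleCat_exact
    (relSingularCohomology.exact_toAbsolute_map (R := R) (M := R) (X := U × ℙ ℂ V) (vert U D.C) (i + 1)) z hz
  obtain ⟨b, hb⟩ := δ_inter_surjective R R D.z₀_mem i (i + 1) rfl (excMap R R D.C D.A (i + 1) ρ)
  refine ⟨b, ?_⟩
  rw [twoPieceKappa_apply, hb, inv_excMap_apply_excMap]

/-- **The kernel of the restriction in high degrees is the image of `θ`.** [cite: HatcherAT2002, §3.2 Thm. 3.16 (proof)] -/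
theorem exists_θ_eq (k' d : ℕ) (e : k' + (2 * n + 1) + 1 = d) (z : singularCohomology R R (U × ℙ ℂ V) d)
    (hz : singularCohomology.map R R (subsetIncl (vert U D.C)) d z = 0) : ∃ c, D.θ R U k' d e c = z := by
  subst e
  obtain ⟨b, rfl⟩ := D.exists_kappa_eq R U z hz
  obtain ⟨b', rfl⟩ := (singularCohomology.mapIso R R (interHomeomorph U D.C D.A) (k' + (2 * n + 1))).toLinearEquiv.surjective b
  obtain ⟨⟨a₁, c⟩, rfl⟩ := ((D.isCupSphere_gZ R).split U k').2 b'
  refine ⟨c, ?_⟩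
  change _ = twoPieceKappa R R D.isOpen_C D.isOpen_A D.C_union_A (k' + (2 * n + 1))
    (singularCohomology.map R R (interHomeomorph U D.C D.A : C(↥(inter U D.C D.A), U × ↥(D.C ∩ D.A))) (k' + (2 * n + 1))
      (sphereSplit R (D.gZ R) U k' (a₁, c)))
  rw [map_interHomeomorph_sphereSplit, map_add, kappa_fstInter, zero_add, θ, degCast_rfl]

/-- **The restriction is injective in degrees `< 2n + 2`.** [cite: HatcherAT2002, §3.2 Thm. 3.16 (proof)] -/
theorem eq_zero_of_res_eq_zero {k : ℕ} (hk : k < 2 * (n + 1)) (z : singularCohomology R R (U × ℙ ℂ V) k)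
    (hz : singularCohomology.map R R (subsetIncl (vert U D.C)) k z = 0) : z = 0 := by
  cases k with
  | zero =>
    haveI := isIso_excMap R R (U := U) D.isOpen_C D.isOpen_A D.C_union_A 0
    obtain ⟨ρ, rfl⟩ := exists_of_moduleCat_exact
      (relSingularCohomology.exact_toAbsolute_map (R := R) (M := R) (X := U × ℙ ℂ V) (vert U D.C) 0) z hz
    have h0 : excMap R R D.C D.A 0 ρ = 0 := relSingularCohomology_inter_zero_eq_zero R R D.z₀_mem _
    rw [← inv_excMap_apply_excMap R R (Y₂ := D.A) 0 ρ, h0, map_zero, map_zero]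
  | succ i =>
    obtain ⟨b, rfl⟩ := D.exists_kappa_eq R U z hz
    obtain ⟨b', rfl⟩ := (singularCohomology.mapIso R R (interHomeomorph U D.C D.A) i).toLinearEquiv.surjective b
    obtain ⟨a₁, rfl⟩ := ((D.isCupSphere_gZ R).low U i (by omega)).2 b'
    have e1 : (singularCohomology.mapIso R R (interHomeomorph U D.C D.A) i).toLinearEquiv
        (singularCohomology.map R R (ContinuousMap.fst : C(U × ↥(D.C ∩ D.A), U)) i a₁) =
        singularCohomology.map R R (fstInter U D.C D.A) i a₁ := by
      change singularCohomology.map R R (interHomeomorph U D.C D.A : C(↥(inter U D.C D.A), U × ↥(D.C ∩ D.A))) i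
        (singularCohomology.map R R ContinuousMap.fst i a₁) = _
      rw [← ModuleCat.comp_apply, ← singularCohomology.map_comp]
      rfl
    rw [e1]
    exact D.kappa_fstInter R U i a₁

/-- **`θ` is injective** (uses the splitting of the pair sequence, i.e. the induction hypothesis).
[cite: HatcherAT2002, §3.2 Thm. 3.16 (proof)] -/
theorem eq_zero_of_θ_eq_zero (hW : IsProjLH R D.Hyp (n + 1)) (k' d : ℕ) (e : k' + (2 * n + 1) + 1 = d)
    (c : singularCohomology R R U k') (h : D.θ R U k' d e c = 0) : c = 0 := by
  subst e
  rw [θ, degCast_rfl, twoPieceKappa_apply] at h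
  haveI := isIso_excMap R R (U := U) D.isOpen_C D.isOpen_A D.C_union_A (k' + (2 * n + 1) + 1)
  have h1 := D.toAbsolute_eq_zero R U hW _ _ h
  rw [inv_excMap_eq_zero_iff] at h1
  have hmem := (δ_inter_eq_zero_iff_mem_range R R _ _ rfl _).1 h1
  rw [range_map_subsetIncl_inter R R (k' + (2 * n + 1))] at hmem
  obtain ⟨w, hw⟩ := hmem
  change singularCohomology.map R R (fstInter U D.C D.A) (k' + (2 * n + 1)) w = _ at hw
  have hinj := (singularCohomology.mapIso R R (interHomeomorph U D.C D.A) (k' + (2 * n + 1))).toLinearEquiv.injective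
  have hzero : sphereSplit R (D.gZ R) U k' (-w, c) = sphereSplit R (D.gZ R) U k' (0, 0) := by
    apply hinj
    change singularCohomology.map R R (interHomeomorph U D.C D.A : C(↥(inter U D.C D.A), U × ↥(D.C ∩ D.A))) _ _ =
      singularCohomology.map R R (interHomeomorph U D.C D.A : C(↥(inter U D.C D.A), U × ↥(D.C ∩ D.A))) _ _
    rw [map_interHomeomorph_sphereSplit, map_interHomeomorph_sphereSplit, ← hw, map_neg, map_zero, map_zero,
      LinearMap.map_zero]
    abel
  exact congrArg Prod.snd (((D.isCupSphere_gZ R).split U k').1 hzero)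

/-! #### The top class: `xⁿ⁺¹ = unit • g_Y` -/

/-- **In degree `2n`, `H²ⁿ(pt × ℙ(V))` is spanned by `pr₂^* xⁿ`** (restriction to the piece is
injective there, and `H²ⁿ(pt × ℙ(W))` is spanned by `pr₂^* x_Wⁿ`). [cite: HusemollerFibreBundles1994, Ch. 17 §2 Thm. 2.3] -/
theorem exists_eq_smul_xpow (hW : IsProjLH R D.Hyp (n + 1)) (y : singularCohomology R R (PUnit.{1} × ℙ ℂ V) (2 * n)) :
    ∃ r : R, y = r • singularCohomology.map R R (ContinuousMap.snd : C(PUnit.{1} × ℙ ℂ V, ℙ ℂ V)) (2 * n) (xpow R V n) := by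
  obtain ⟨w, hw⟩ := (D.bijective_lhMap_piece R PUnit.{1} hW (2 * n)).2
    (singularCohomology.map R R (subsetIncl (vert PUnit.{1} D.C)) (2 * n) y)
  have hres : restrictSrc R n (2 * n) w = 0 := src_punit_eq_zero R (N := n) (k := 2 * n) (fun j hj ↦ by omega) _
  have h2n : 2 * n ≤ 2 * n := le_rfl
  -- the top component of `w` is `r • 1`, so `y| = r • cls_last`
  have e₀ : 2 * n - 2 * n = 0 := Nat.sub_self _
  have main : ∃ r : R, singularCohomology.map R R (subsetIncl (vert PUnit.{1} D.C)) (2 * n) y =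
      r • singularCohomology.map R R (subsetIncl (vert PUnit.{1} D.C)) (2 * n)
        (singularCohomology.map R R (ContinuousMap.snd : C(PUnit.{1} × ℙ ℂ V, ℙ ℂ V)) (2 * n) (xpow R V n)) := by
    rw [← hw, lhMap_succ, hres, LinearMap.map_zero, zero_add, dif_pos h2n]
    obtain ⟨x₀, hx⟩ : ∃ x₀ : singularCohomology R R PUnit.{1} (2 * n - 2 * n), x₀ = w ⟨Fin.last n, h2n⟩ := ⟨_, rfl⟩
    rw [← hx]
    obtain ⟨r, hr⟩ := punit_zero_eq_smul_one R (degCast R e₀ x₀)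
    refine ⟨r, ?_⟩
    change cupProduct (Nat.sub_add_cancel h2n) (singularCohomology.map R R (fstVert PUnit.{1} D.C) (2 * n - 2 * n) x₀)
      (singularCohomology.map R R (subsetIncl (vert PUnit.{1} D.C)) (2 * n)
        (singularCohomology.map R R (ContinuousMap.snd : C(PUnit.{1} × ℙ ℂ V, ℙ ℂ V)) (2 * n) (xpow R V n))) = _
    rw [← cupProduct_degCast_left R e₀ (show 0 + 2 * n = 2 * n by simp) (Nat.sub_add_cancel h2n),
      ← map_degCast, hr, map_smul, singularCohomology.map_one, smul_cupProduct, one_cupProduct]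
  obtain ⟨r, hr⟩ := main
  refine ⟨r, sub_eq_zero.1 (D.eq_zero_of_res_eq_zero R PUnit.{1} (k := 2 * n) (by omega) _ ?_)⟩
  rw [map_sub, map_smul, hr, sub_self]

/-- **`xⁿ⁺¹ = r₂ • g_Y` on `pt × ℙ(V)` with `r₂` a unit**: by the kernel analysis `pr₂^* xⁿ⁺¹ = θ(c₀)`,
`c₀ = r₂ • 1`; by the Gysin surjectivity `g_Y = y ⌣ x = r₁ xⁿ⁺¹`; so `r₁ r₂ = 1`.
[cite: MilnorStasheff1974, §14 Thm. 14.4] [cite: HusemollerFibreBundles1994, Ch. 17 §2 Thm. 2.3] -/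
theorem exists_unit_smul_gY (hW : IsProjLH R D.Hyp (n + 1)) : ∃ r₂ : R, IsUnit r₂ ∧
    singularCohomology.map R R (ContinuousMap.snd : C(PUnit.{1} × ℙ ℂ V, ℙ ℂ V)) (2 * n + 1 + 1) (xpow R V (n + 1)) =
      r₂ • singularCohomology.map R R (ContinuousMap.snd : C(PUnit.{1} × ℙ ℂ V, ℙ ℂ V)) (2 * n + 1 + 1) (D.gY R) := by
  have e : 0 + (2 * n + 1) + 1 = 2 * n + 1 + 1 := by omega
  -- (1) `pr₂^* xⁿ⁺¹ = θ(c₀)`, `c₀ = r₂ • 1`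
  obtain ⟨c₀, hc₀⟩ := D.exists_θ_eq R PUnit.{1} 0 _ e
    (singularCohomology.map R R (ContinuousMap.snd : C(PUnit.{1} × ℙ ℂ V, ℙ ℂ V)) (2 * n + 1 + 1) (xpow R V (n + 1)))
    (D.res_projCls_last R PUnit.{1} hW)
  obtain ⟨r₂, rfl⟩ := punit_zero_eq_smul_one R c₀
  have hθ1 : D.θ R PUnit.{1} 0 _ e (singularCohomology.one R PUnit.{1}) =
      singularCohomology.map R R (ContinuousMap.snd : C(PUnit.{1} × ℙ ℂ V, ℙ ℂ V)) (2 * n + 1 + 1) (D.gY R) := by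
    rw [θ_eq, singularCohomology.map_one, cupProduct_one]
  rw [θ_smul, hθ1] at hc₀
  refine ⟨r₂, ?_, hc₀.symm⟩
  -- (2) Gysin: `g_Y = y₀ ⌣ x`, `pr₂^* y₀ = r₁ • pr₂^* xⁿ`
  obtain ⟨y₀, hy₀⟩ := cup_tautEuler_surjective V R D.hV (by omega) (k := 2 * n) (by omega) (D.gY R)
  obtain ⟨r₁, hr₁⟩ := D.exists_eq_smul_xpow R hW (singularCohomology.map R R (ContinuousMap.snd : C(PUnit.{1} × ℙ ℂ V, ℙ ℂ V)) (2 * n) y₀)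
  have hG : singularCohomology.map R R (ContinuousMap.snd : C(PUnit.{1} × ℙ ℂ V, ℙ ℂ V)) (2 * n + 1 + 1) (D.gY R) =
      r₁ • singularCohomology.map R R (ContinuousMap.snd : C(PUnit.{1} × ℙ ℂ V, ℙ ℂ V)) (2 * n + 1 + 1) (xpow R V (n + 1)) := by
    change _ = r₁ • singularCohomology.map R R ContinuousMap.snd (2 * n + 2)
      (cupProduct (show 2 * n + 2 = 2 * (n + 1) by omega) (xpow R V n) (tautEuler V R 1))
    rw [cupProduct_map, ← smul_cupProduct, ← hr₁, ← cupProduct_map]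
    exact (congrArg (singularCohomology.map R R (ContinuousMap.snd : C(PUnit.{1} × ℙ ℂ V, ℙ ℂ V)) (2 * n + 2)) hy₀).symm
  -- (3) `(1 - r₁ r₂) • θ(1) = 0`, so `r₁ r₂ = 1`
  have h3 : D.θ R PUnit.{1} 0 _ e ((1 - r₁ * r₂) • singularCohomology.one R PUnit.{1}) = 0 := by
    rw [θ_smul, hθ1, sub_smul, one_smul, mul_smul, hc₀, ← hG, sub_self]
  have h4 := eq_zero_of_smul_one_punit R (D.eq_zero_of_θ_eq_zero R PUnit.{1} hW 0 _ e _ h3)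
  exact IsUnit.of_mul_eq_one r₁ (by rw [sub_eq_zero] at h4; rw [mul_comm]; exact h4.symm)

/-- **The top class on `U × ℙ(V)`: `pr₂^* xⁿ⁺¹ = r₂ • pr₂^* g_Y`, `r₂` a unit.** [cite: HusemollerFibreBundles1994, Ch. 17 §2 Thm. 2.3] -/
theorem projCls_last_eq (hW : IsProjLH R D.Hyp (n + 1)) : ∃ r₂ : R, IsUnit r₂ ∧
    projCls R V U (n + 2) (Fin.last (n + 1)) =
      r₂ • singularCohomology.map R R (ContinuousMap.snd : C(U × ℙ ℂ V, ℙ ℂ V)) (2 * n + 1 + 1) (D.gY R) := by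
  obtain ⟨r₂, hr₂, h⟩ := D.exists_unit_smul_gY R hW
  refine ⟨r₂, hr₂, ?_⟩
  have hsnd : (ContinuousMap.snd : C(U × ℙ ℂ V, ℙ ℂ V)) =
      (ContinuousMap.snd : C(PUnit.{1} × ℙ ℂ V, ℙ ℂ V)).comp (prodMapId (toPt U)) := rfl
  change singularCohomology.map R R (ContinuousMap.snd : C(U × ℙ ℂ V, ℙ ℂ V)) (2 * n + 1 + 1) (xpow R V (n + 1)) = _
  rw [hsnd, singularCohomology.map_comp, ModuleCat.comp_apply, ModuleCat.comp_apply, h, map_smul]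

/-! #### Assembly of the inductive step -/

/-- The top component, cast to degree `k'` (`k = k' + 2n + 2`). [folklore] -/
theorem lhMap_topSrc (k' : ℕ) (h : 2 * (n + 1) ≤ k' + (2 * n + 1) + 1) (e' : k' + (2 * n + 1) + 1 - 2 * (n + 1) = k') (r₂ : R)
    (hlast : projCls R V U (n + 2) (Fin.last (n + 1)) =
      r₂ • singularCohomology.map R R (ContinuousMap.snd : C(U × ℙ ℂ V, ℙ ℂ V)) (2 * n + 1 + 1) (D.gY R))
    (c : singularCohomology R R U k') :
    lhMap R (evenDeg (n + 2)) (ContinuousMap.fst : C(U × ℙ ℂ V, U)) (projCls R V U (n + 2)) (k' + (2 * n + 1) + 1)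
      (topSrc R (n + 1) _ h (degCast R e'.symm c)) =
      r₂ • D.θ R U k' _ rfl c := by
  rw [lhMap_succ, restrictSrc_topSrc, LinearMap.map_zero, zero_add, dif_pos h, topSrc_last, hlast, LinearMap.map_smul,
    map_degCast, cupProduct_degCast_left R _ _ (show k' + (2 * n + 1 + 1) = k' + (2 * n + 1) + 1 by omega),
    cupProduct_gradedComm_holds R (U × ℙ ℂ V) _ (show (2 * n + 1 + 1) + k' = k' + (2 * n + 1) + 1 by omega),
    Even.neg_one_pow ⟨k' * (n + 1), by ring⟩, one_smul, θ_eq]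

/-- **The inductive step: `LH(W, n+1) ⇒ LH(V, n+2)`.** [cite: HusemollerFibreBundles1994, Ch. 17 §2 Thm. 2.5] [cite: HatcherAT2002, §3.2 Thm. 3.16] -/
theorem isProjLH_succ (hW : IsProjLH R D.Hyp (n + 1)) : IsProjLH R V (n + 2) := by
  intro U _ k
  obtain ⟨r₂, hr₂, hlast⟩ := D.projCls_last_eq R U hW
  obtain ⟨s, hs⟩ := hr₂.exists_left_inv
  have hlow := D.bijective_lhMap_piece R U hW k
  constructor
  · rw [injective_iff_map_eq_zero]
    intro a ha
    have hres : restrictSrc R (n + 1) k a = 0 := hlow.1 (by rw [← res_lhMap R D U hW, ha, map_zero, LinearMap.map_zero])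
    by_cases hk : 2 * (n + 1) ≤ k
    · obtain ⟨k', rfl⟩ : ∃ k', k = k' + (2 * n + 1) + 1 := ⟨k - 2 * (n + 1), by omega⟩
      have e' : k' + (2 * n + 1) + 1 - 2 * (n + 1) = k' := by omega
      set c : singularCohomology R R U k' := degCast R e' (a ⟨Fin.last (n + 1), hk⟩) with hc
      have ha' : a = topSrc R (n + 1) _ hk (degCast R e'.symm c) := by
        rw [hc, degCast_symm_apply_degCast]
        conv_lhs => rw [← extendSrc_restrictSrc_add_topSrc R (n + 1) _ hk a, hres, extendSrc_zero, zero_add]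
      rw [ha', D.lhMap_topSrc R U k' hk e' r₂ hlast, IsUnit.smul_eq_zero hr₂] at ha
      have hc0 := D.eq_zero_of_θ_eq_zero R U hW k' _ rfl c ha
      rw [ha', hc0, map_zero, topSrc_zero]
    · rw [← extendSrc_restrictSrc R (n + 1) k hk a, hres, extendSrc_zero]
  · intro z
    obtain ⟨w, hw⟩ := hlow.2 (singularCohomology.map R R (subsetIncl (vert U D.C)) k z)
    set a₀ := extendSrc R (n + 1) k w with ha₀
    have hz : singularCohomology.map R R (subsetIncl (vert U D.C)) k
        (z - lhMap R (evenDeg (n + 2)) ContinuousMap.fst (projCls R V U (n + 2)) k a₀) = 0 := by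
      rw [map_sub, res_lhMap R D U hW, ha₀, restrictSrc_extendSrc, hw, sub_self]
    by_cases hk : 2 * (n + 1) ≤ k
    · obtain ⟨k', rfl⟩ : ∃ k', k = k' + (2 * n + 1) + 1 := ⟨k - 2 * (n + 1), by omega⟩
      obtain ⟨c, hc⟩ := D.exists_θ_eq R U k' _ rfl _ hz
      have e' : k' + (2 * n + 1) + 1 - 2 * (n + 1) = k' := by omega
      refine ⟨a₀ + s • topSrc R (n + 1) _ hk (degCast R e'.symm c), ?_⟩
      rw [map_add, map_smul, D.lhMap_topSrc R U k' hk e' r₂ hlast, smul_smul, hs, one_smul, hc, add_sub_cancel]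
    · exact ⟨a₀, (sub_eq_zero.1 (D.eq_zero_of_res_eq_zero R U (by omega) _ hz)).symm⟩

end CellData

end Step

/-! ### The theorem -/

/-- **Leray–Hirsch for `U × ℙ(V) → U`** (Husemoller Thm. 2.5 in the product case / Hatcher
Thm. 3.16 for `ℂPⁿ`): for `dim V = n + 1` and every space `U`,
`(aⱼ)_{j ≤ n} ↦ Σⱼ pr₁^* aⱼ ⌣ pr₂^* xʲ : Π_{2j ≤ k} Hᵏ⁻²ʲ(U; R) → Hᵏ(U × ℙ(V); R)` is bijective.
[cite: HusemollerFibreBundles1994, Ch. 17 §2 Thm. 2.5] [cite: HatcherAT2002, §3.2 Thm. 3.16] -/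
theorem projectiveSpace_lerayHirsch (R : Type) [CommRing R] :
    ∀ (n : ℕ) (V : Type) [NormedAddCommGroup V] [NormedSpace ℂ V] [FiniteDimensional ℂ V],
      finrank ℂ V = n + 1 → IsProjLH R V (n + 1)
  | 0, V, _, _, _, hV => isProjLH_one R V hV
  | n + 1, V, _, _, _, hV => by
    have hpos : 0 < finrank ℂ V := by omega
    obtain ⟨u, hu0⟩ := (finrank_pos_iff_exists_ne_zero (R := ℂ)).1 hpos
    obtain ⟨ψ, hψ⟩ := SeparatingDual.exists_eq_one (R := ℂ) hu0
    let D : CellData V n := ⟨ψ, u, hψ, hV⟩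
    exact D.isProjLH_succ R (projectiveSpace_lerayHirsch R n D.Hyp D.finrank_hyp)


end Literature.AlgebraicTopology.CharacteristicClasses
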